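import Summits.QuantumFields.YangMills.Theorems.BalabanUVNodesN15KingModelBoxDeterminant
import HarnessLib

/-!
# BalabanUVNodes ∕ N15 — THE KING-MODEL RUNG (PART Ϟ-s): SUM RULES AND THE RESOLVENT IDENTITY IN THE MASS FOR KING's NEUMANN GREEN's FUNCTION —
# `Σ_tG^Ω(s,t) = 1∕m²` (constants are the zero mode of `−Δ_free`), `G^Ω(s,t) ≤ 1∕m²`, `G^Ω_{m₁²} − G^Ω_{m₂²} = (m₂²−m₁²)·G^Ω_{m₁²}G^Ω_{m₂²}`, `∂_{m²}G^Ω(s,t) = −Σ_uG^Ω(s,u)G^Ω(u,t)`,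
# `|G^Ω_{m₁²}(s,t) − G^Ω_{m₂²}(s,t)| ≤ |m₁²−m₂²|∕(m₁²m₂²)`; the torus row sum `Σ_yG_T(x,y) = 1∕m²`
# (Track A, DAG node N15 = NE2; FAN-OUT v1.1 §N15 s3 «KING-MODEL RUNG»; King (2.17) p.653, §4 p.670 l.8–13; count-neutral)

HONEST FRAMING.  Count-neutral (cell `pub-ymgap`, seat `pub-ymgap-dag-n15-e` g41; `--supports stmt-QuantumFields-27366 --as helper` = K3⁸).  TEMPLATE LITERATURE: C. King, Commun. Math.
Phys. **102** (1986) 649–677 [King1986]: (2.13) p.653 (`c(−Δ)+m²`), (2.17) p.653 (covariances), (4.4) p.670, §4 p.670 l.8–13 (King's region `Ω` with free boundary conditions = the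
image sum over the doubled torus).  Part Ϟ-c diagonalised `(c(−Δ_free)+m²)_Ω` (`boxOp`) by the cosine waves `w_k` (`boxOp_mulVec_boxWave`, `boxOp_inv_mulVec_boxWave`,
`kingBoxGreen_eq_sum_boxWave`); part Ϻ proved the torus resolvent identity and `lapF_inv_anti_mass`.  THIS FILE: §1 TORUS ROW SUM `lapSym_zero_momentum` (`lapSym(0) = m²`),
★ `lapF_mulVec_one` (`(c(−Δ)+m²)1 = m²1`), ★★ **`sum_lapF_inv_eq_inv_mass`** (`Σ_yG_T(x,y) = 1∕m²` on every torus); §2 BOX ROW SUM `boxWave_zero` (`w_0 = 1`), `dblBox_zero`,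
★ `boxOp_mulVec_one`, `boxOp_inv_mulVec_one`, ★★ **`sum_kingBoxGreen_eq_inv_mass`** (`Σ_tG^Ω(s,t) = 1∕m²`: the constants are the Neumann zero mode), ★★ **`kingBoxGreen_le_inv_mass`**
(`0 ≤ G^Ω(s,t) ≤ 1∕m²` entrywise — the box twin of Ε-e's `lapF_inv_diag_le_inv_mass`), `sum_sum_kingBoxGreen`; §3 RESOLVENT IDENTITY `boxOp_sub_boxOp` (`B_{m₂²} − B_{m₁²} = (m₂²−m₁²)·1`),
★★ **`boxOp_inv_sub_inv`** (`B_{m₁²}⁻¹ − B_{m₂²}⁻¹ = (m₂²−m₁²)B_{m₁²}⁻¹B_{m₂²}⁻¹`), ★★ `kingBoxGreen_sub_eq` (entrywise), ★★ **`kingBoxGreen_anti_mass`** (`m₁² ≤ m₂² ⇒ G^Ω_{m₂²} ≤ G^Ω_{m₁²}`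
entrywise), ★★ **`abs_kingBoxGreen_sub_le`** (MASS-LIPSCHITZ: `|G^Ω_{m₁²}(s,t) − G^Ω_{m₂²}(s,t)| ≤ |m₁²−m₂²|∕(m₁²m₂²)`); §4 THE MASS DERIVATIVE ★ `sum_kingBoxGreen_mul_kingBoxGreen`
(`Σ_uG(s,u)G(u,t) = Σ_k w_k(s)w_k(t)∕(lapSym(k̂)²·weight_k)` in the cosine basis), `lapSym_eq_add_mass`, ★★★ **`hasDerivAt_kingBoxGreen`** (`∂_{m²}G^Ω(s,t) = −Σ_uG^Ω(s,u)G^Ω(u,t)`),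
★★ `hasDerivAt_kingBoxGreen_diag` (`∂_{m²}G^Ω(s,s) = −Σ_uG^Ω(s,u)²`), ★ `sum_kingBoxGreen_mul_kingBoxGreen_le` (`0 ≤ Σ_uG(s,u)G(u,t) ≤ 1∕m⁴`).

PRIOR TREE ART (named, USED not restated): Ϟ-a (`boxWave`, `boxWaveWeight_pos`), Ϟ-c (`boxOp_mulVec_boxWave`, `boxOp_inv_mulVec_boxWave`, `kingBoxGreen_eq_sum_boxWave`, `lapF_eigen_chi`,
`det_boxOp_pos`), Ν-a′∕Ν-b (`kingBoxGreen`, `boxOp_inv_eq_kingBoxGreen`, `kingBoxGreen_nonneg`, `kingBoxGreen_symm`), Ε-k (`det_lapF_pos`), `King1986` (`lapF`, `lapSym`, `lapSym_ge`),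
`B5Prop11Plancherel` (`Tor`, `chi`, `chi_zero_left`, `sOf_zero`).  NOT Bałaban's covariant objects; NOT a node discharge (N15 is booked through n15-a's knit, untouched); nothing
continuum-YM ∕ `ℝ⁴` ∕ OS ∕ Clay.  0 `sorry`; 0 `def`.

HONEST SCOPE.  King's `A = 0` free operator with free boundary conditions on a box `Ω = Π_μ{0,…,n_μ−1}` (and the periodic one on `Πℤ∕K_μ` in §1), `c ≥ 0`, masses `> 0`.
Locators: [King1986] (2.13)∕(2.17) p.653, (4.4) p.670, §4 p.670 l.8–13.
-/

noncomputable section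

open scoped BigOperators
open Finset Matrix

namespace Summit.QuantumFields.YangMills.BalabanUVNodes.N15KingModelRung.TorusSpectral

open Literature.MathematicalPhysics.QuantumFieldTheory.Balaban1983to89.B5Prop11Plancherel (Tor chi chi_zero_left sOf sOf_zero)
open Literature.MathematicalPhysics.QuantumFieldTheory.King1986.Torus
open Summit.QuantumFields.YangMills.BalabanUVNodes.N15KingModelRung.ProperTime (lapF_inv_nonneg)

variable {d : ℕ}

/-! ## §1 The torus row sum -/

section TorusRow

variable (K : Fin (d + 1) → ℕ) [hK : ∀ i, NeZero (K i)]

omit hK in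
/-- `lapSym(0) = m²` (the zero momentum). [cite: King1986, (2.13) p.653, (4.4) p.670] -/
theorem lapSym_zero_momentum (c m2 : ℝ) : lapSym K c m2 0 = m2 := by
  unfold lapSym
  simp

/-- ★ **`(c(−Δ)+m²)·1 = m²·1` ON THE TORUS** (the constants are the zero mode of `−Δ`). [cite: King1986, (2.13) p.653] -/
theorem lapF_mulVec_one (c m2 : ℝ) : lapF K c m2 *ᵥ (fun _ => (1 : ℝ)) = fun _ => m2 := by
  funext x
  have h := lapF_eigen_chi K c m2 0 x
  simp only [chi_zero_left, mul_one, lapSym_zero_momentum] at h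
  rw [← Complex.ofReal_sum] at h
  have h' : ∑ y, lapF K c m2 x y = m2 := by exact_mod_cast h
  simpa [Matrix.mulVec, dotProduct] using h'

/-- ★★ **THE TORUS ROW SUM `Σ_y G_T(x,y) = 1∕m²`** (`c ≥ 0`, `m² > 0`). [cite: King1986, (2.17) p.653, (4.4) p.670] -/
theorem sum_lapF_inv_eq_inv_mass {c m2 : ℝ} (hc : 0 ≤ c) (hm : 0 < m2) (x : Tor K) : ∑ y, (lapF K c m2)⁻¹ x y = m2⁻¹ := by
  have hdet : IsUnit (lapF K c m2).det := isUnit_iff_ne_zero.mpr (det_lapF_pos K hc hm).ne'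
  have h1 : (lapF K c m2)⁻¹ *ᵥ (lapF K c m2 *ᵥ fun _ => (1 : ℝ)) = fun _ => 1 := by
    rw [Matrix.mulVec_mulVec, Matrix.nonsing_inv_mul _ hdet, Matrix.one_mulVec]
  rw [lapF_mulVec_one] at h1
  have h2 := congrFun h1 x
  simp only [Matrix.mulVec, dotProduct] at h2
  rw [← Finset.sum_mul] at h2
  exact eq_inv_of_mul_eq_one_left h2

end TorusRow

/-! ## §2 The box row sum -/

section BoxRow

variable (n : Fin (d + 1) → ℕ) [hn : ∀ μ, NeZero (n μ)]

/-- `w_0 = 1` (the constant cosine wave). [folklore] -/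
theorem boxWave_zero : boxWave n 0 = fun _ => 1 := by
  funext s
  unfold boxWave
  simp

/-- the doubled-torus image of the corner `0 ∈ Ω` is `0`. [folklore] -/
theorem dblBox_zero : dblBox n (0 : KingBox n) = 0 := by
  funext μ
  simp [dblBox]

/-- ★ **`(c(−Δ_free)+m²)_Ω·1 = m²·1`** (the constants are the zero mode of the free-boundary Laplacian). [cite: King1986, (2.13) p.653, §4 p.670 l.8–13] -/
theorem boxOp_mulVec_one (c m2 : ℝ) : boxOp n c m2 *ᵥ (fun _ => (1 : ℝ)) = fun _ => m2 := by
  have h := boxOp_mulVec_boxWave n c m2 0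
  rw [boxWave_zero, dblBox_zero, lapSym_zero_momentum] at h
  rw [h]
  funext s
  simp

/-- `(c(−Δ_free)+m²)_Ω⁻¹·1 = m⁻²·1`. [cite: King1986, (2.17) p.653, §4 p.670 l.8–13] -/
theorem boxOp_inv_mulVec_one {c m2 : ℝ} (hc : 0 ≤ c) (hm : 0 < m2) : (boxOp n c m2)⁻¹ *ᵥ (fun _ => (1 : ℝ)) = fun _ => m2⁻¹ := by
  have h := boxOp_inv_mulVec_boxWave n hc hm 0
  rw [boxWave_zero, dblBox_zero, lapSym_zero_momentum] at h
  rw [h]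
  funext s
  simp

/-- ★★ **THE BOX ROW SUM `Σ_t G^Ω(s,t) = 1∕m²`** at every site (`c ≥ 0`, `m² > 0`). [cite: King1986, (2.17) p.653, §4 p.670 l.8–13] -/
theorem sum_kingBoxGreen_eq_inv_mass {c m2 : ℝ} (hc : 0 ≤ c) (hm : 0 < m2) (s : KingBox n) : ∑ t, kingBoxGreen n c m2 s t = m2⁻¹ := by
  have h := congrFun (boxOp_inv_mulVec_one n hc hm) s
  simp only [Matrix.mulVec, dotProduct, mul_one] at h
  rw [← h]
  exact Finset.sum_congr rfl fun t _ => (boxOp_inv_eq_kingBoxGreen n hc hm s t).symm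

/-- ★★ **`G^Ω(s,t) ≤ 1∕m²` ENTRYWISE** (one non-negative term of the row sum). [cite: King1986, (2.17) p.653, §4 p.670 l.8–13] -/
theorem kingBoxGreen_le_inv_mass {c m2 : ℝ} (hc : 0 ≤ c) (hm : 0 < m2) (s t : KingBox n) : kingBoxGreen n c m2 s t ≤ m2⁻¹ := by
  rw [← sum_kingBoxGreen_eq_inv_mass n hc hm s]
  exact Finset.single_le_sum (fun u _ => kingBoxGreen_nonneg n hc hm s u) (Finset.mem_univ t)

/-- the total `Σ_sΣ_t G^Ω(s,t) = |Ω|∕m²`. [cite: King1986, (2.17) p.653, §4 p.670 l.8–13] -/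
theorem sum_sum_kingBoxGreen {c m2 : ℝ} (hc : 0 ≤ c) (hm : 0 < m2) :
    ∑ s, ∑ t, kingBoxGreen n c m2 s t = (Fintype.card (KingBox n) : ℝ) * m2⁻¹ := by
  simp [sum_kingBoxGreen_eq_inv_mass n hc hm]

end BoxRow

/-! ## §3 The resolvent identity in the mass and its consequences -/

section Resolvent

variable (n : Fin (d + 1) → ℕ) [hn : ∀ μ, NeZero (n μ)]

/-- `(c(−Δ_free)+m₂²)_Ω − (c(−Δ_free)+m₁²)_Ω = (m₂²−m₁²)·1`. [cite: King1986, (2.13) p.653] -/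
theorem boxOp_sub_boxOp (c m1 m2 : ℝ) : boxOp n c m2 - boxOp n c m1 = (m2 - m1) • (1 : Matrix (KingBox n) (KingBox n) ℝ) := by
  ext s t
  simp only [boxOp, Matrix.sub_apply, Matrix.smul_apply, Matrix.one_apply, smul_eq_mul]
  by_cases h : t = s
  · subst h; simp
  · rw [if_neg h, if_neg (fun h' => h h'.symm)]; ring

/-- ★★ **THE RESOLVENT IDENTITY**: `B_{m₁²}⁻¹ − B_{m₂²}⁻¹ = (m₂²−m₁²)·B_{m₁²}⁻¹B_{m₂²}⁻¹` for `B_{m²} = (c(−Δ_free)+m²)_Ω` (`c ≥ 0`, masses `> 0`). [cite: King1986, (2.17) p.653, §4 p.670 l.8–13] -/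
theorem boxOp_inv_sub_inv {c m1 m2 : ℝ} (hc : 0 ≤ c) (h1 : 0 < m1) (h2 : 0 < m2) :
    (boxOp n c m1)⁻¹ - (boxOp n c m2)⁻¹ = (m2 - m1) • ((boxOp n c m1)⁻¹ * (boxOp n c m2)⁻¹) := by
  have hd1 : IsUnit (boxOp n c m1).det := isUnit_iff_ne_zero.mpr (det_boxOp_pos n hc h1).ne'
  have hd2 : IsUnit (boxOp n c m2).det := isUnit_iff_ne_zero.mpr (det_boxOp_pos n hc h2).ne'
  have key : (boxOp n c m1)⁻¹ * (boxOp n c m2 - boxOp n c m1) * (boxOp n c m2)⁻¹ = (boxOp n c m1)⁻¹ - (boxOp n c m2)⁻¹ := by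
    rw [Matrix.mul_sub, Matrix.sub_mul, Matrix.mul_assoc, Matrix.mul_nonsing_inv _ hd2, Matrix.mul_one, Matrix.nonsing_inv_mul _ hd1, Matrix.one_mul]
  rw [← key, boxOp_sub_boxOp, Matrix.mul_smul, Matrix.mul_one, Matrix.smul_mul]

/-- ★★ entrywise: `G^Ω_{m₁²}(s,t) − G^Ω_{m₂²}(s,t) = (m₂²−m₁²)·Σ_uG^Ω_{m₁²}(s,u)G^Ω_{m₂²}(u,t)`. [cite: King1986, (2.17) p.653, §4 p.670 l.8–13] -/
theorem kingBoxGreen_sub_eq {c m1 m2 : ℝ} (hc : 0 ≤ c) (h1 : 0 < m1) (h2 : 0 < m2) (s t : KingBox n) :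
    kingBoxGreen n c m1 s t - kingBoxGreen n c m2 s t = (m2 - m1) * ∑ u, kingBoxGreen n c m1 s u * kingBoxGreen n c m2 u t := by
  have h := congrFun (congrFun (boxOp_inv_sub_inv n hc h1 h2) s) t
  rw [Matrix.sub_apply, Matrix.smul_apply, smul_eq_mul, Matrix.mul_apply, boxOp_inv_eq_kingBoxGreen n hc h1, boxOp_inv_eq_kingBoxGreen n hc h2] at h
  rw [h]
  congr 1
  exact Finset.sum_congr rfl fun u _ => by rw [boxOp_inv_eq_kingBoxGreen n hc h1, boxOp_inv_eq_kingBoxGreen n hc h2]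

/-- ★★ **THE NEUMANN GREEN's FUNCTION DECREASES WITH THE MASS**, entrywise: `0 < m₁² ≤ m₂² ⇒ G^Ω_{m₂²}(s,t) ≤ G^Ω_{m₁²}(s,t)`. [cite: King1986, (2.17) p.653, §4 p.670 l.8–13] -/
theorem kingBoxGreen_anti_mass {c m1 m2 : ℝ} (hc : 0 ≤ c) (h1 : 0 < m1) (h12 : m1 ≤ m2) (s t : KingBox n) : kingBoxGreen n c m2 s t ≤ kingBoxGreen n c m1 s t := by
  have h2 : 0 < m2 := lt_of_lt_of_le h1 h12
  rw [← sub_nonneg, kingBoxGreen_sub_eq n hc h1 h2]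
  exact mul_nonneg (by linarith) (Finset.sum_nonneg fun u _ => mul_nonneg (kingBoxGreen_nonneg n hc h1 s u) (kingBoxGreen_nonneg n hc h2 u t))

/-- `0 ≤ Σ_uG^Ω_{m₁²}(s,u)G^Ω_{m₂²}(u,t) ≤ 1∕(m₁²m₂²)` (row sum `1∕m₁²`, entries `≤ 1∕m₂²`). [cite: King1986, (2.17) p.653, §4 p.670 l.8–13] -/
theorem sum_kingBoxGreen_mul_kingBoxGreen_le {c m1 m2 : ℝ} (hc : 0 ≤ c) (h1 : 0 < m1) (h2 : 0 < m2) (s t : KingBox n) :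
    0 ≤ ∑ u, kingBoxGreen n c m1 s u * kingBoxGreen n c m2 u t ∧ ∑ u, kingBoxGreen n c m1 s u * kingBoxGreen n c m2 u t ≤ m1⁻¹ * m2⁻¹ := by
  refine ⟨Finset.sum_nonneg fun u _ => mul_nonneg (kingBoxGreen_nonneg n hc h1 s u) (kingBoxGreen_nonneg n hc h2 u t), ?_⟩
  calc ∑ u, kingBoxGreen n c m1 s u * kingBoxGreen n c m2 u t ≤ ∑ u, kingBoxGreen n c m1 s u * m2⁻¹ :=
        Finset.sum_le_sum fun u _ => mul_le_mul_of_nonneg_left (kingBoxGreen_le_inv_mass n hc h2 u t) (kingBoxGreen_nonneg n hc h1 s u)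
    _ = m1⁻¹ * m2⁻¹ := by rw [← Finset.sum_mul, sum_kingBoxGreen_eq_inv_mass n hc h1 s]

/-- ★★ **MASS-LIPSCHITZ BOUND**: `|G^Ω_{m₁²}(s,t) − G^Ω_{m₂²}(s,t)| ≤ |m₁² − m₂²|∕(m₁²m₂²)` for all sites and all masses `> 0`. [cite: King1986, (2.17) p.653, §4 p.670 l.8–13] -/
theorem abs_kingBoxGreen_sub_le {c m1 m2 : ℝ} (hc : 0 ≤ c) (h1 : 0 < m1) (h2 : 0 < m2) (s t : KingBox n) :
    |kingBoxGreen n c m1 s t - kingBoxGreen n c m2 s t| ≤ |m1 - m2| * (m1⁻¹ * m2⁻¹) := by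
  rw [kingBoxGreen_sub_eq n hc h1 h2 s t, abs_mul, abs_sub_comm]
  have h := sum_kingBoxGreen_mul_kingBoxGreen_le n hc h1 h2 s t
  rw [abs_of_nonneg h.1]
  exact mul_le_mul_of_nonneg_left h.2 (abs_nonneg _)

end Resolvent

/-! ## §4 The mass derivative of the Neumann Green's function -/

section Derivative

variable (n : Fin (d + 1) → ℕ) [hn : ∀ μ, NeZero (n μ)]

/-- `lapSym K c m² q = m² + lapSym K c 0 q` (the mass enters additively). [cite: King1986, (2.13) p.653, (4.4) p.670] -/
theorem lapSym_eq_add_mass (K : Fin (d + 1) → ℕ) [∀ i, NeZero (K i)] (c m2 : ℝ) (q : Tor K) : lapSym K c m2 q = m2 + lapSym K c 0 q := by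
  unfold lapSym
  ring

/-- ★ **`Σ_uG^Ω(s,u)G^Ω(u,t)` IN THE COSINE BASIS**: `= Σ_k w_k(s)w_k(t)∕(lapSym(2n)(k̂)²·weight_k)` (apply `G^Ω` to the expansion of its own column). [cite: King1986, (2.17) p.653, §4 p.670 l.8–13] -/
theorem sum_kingBoxGreen_mul_kingBoxGreen {c m2 : ℝ} (hc : 0 ≤ c) (hm : 0 < m2) (s t : KingBox n) :
    ∑ u, kingBoxGreen n c m2 s u * kingBoxGreen n c m2 u t
      = ∑ k : KingBox n, boxWave n k s * boxWave n k t / (lapSym (dblPer n) c m2 (dblBox n k) ^ 2 * boxWaveWeight n k) := by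
  have hcol : ∀ k : KingBox n, ∑ u, kingBoxGreen n c m2 s u * boxWave n k u = (lapSym (dblPer n) c m2 (dblBox n k))⁻¹ * boxWave n k s := by
    intro k
    have h := congrFun (boxOp_inv_mulVec_boxWave n hc hm k) s
    simp only [Matrix.mulVec, dotProduct, Pi.smul_apply, smul_eq_mul] at h
    rw [← h]
    exact Finset.sum_congr rfl fun u _ => by rw [boxOp_inv_eq_kingBoxGreen n hc hm s u]
  calc ∑ u, kingBoxGreen n c m2 s u * kingBoxGreen n c m2 u t
      = ∑ u, ∑ k : KingBox n, kingBoxGreen n c m2 s u * boxWave n k u * (boxWave n k t / (lapSym (dblPer n) c m2 (dblBox n k) * boxWaveWeight n k)) := by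
        refine Finset.sum_congr rfl fun u _ => ?_
        rw [kingBoxGreen_eq_sum_boxWave n hc hm u t, Finset.mul_sum]
        exact Finset.sum_congr rfl fun k _ => by ring
    _ = ∑ k : KingBox n, (∑ u, kingBoxGreen n c m2 s u * boxWave n k u) * (boxWave n k t / (lapSym (dblPer n) c m2 (dblBox n k) * boxWaveWeight n k)) := by
        rw [Finset.sum_comm]
        exact Finset.sum_congr rfl fun k _ => by rw [Finset.sum_mul]
    _ = _ := by
        refine Finset.sum_congr rfl fun k _ => ?_
        have hσ : lapSym (dblPer n) c m2 (dblBox n k) ≠ 0 := (lt_of_lt_of_le hm (lapSym_ge (dblPer n) c m2 hc _)).ne'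
        have hW : boxWaveWeight n k ≠ 0 := (boxWaveWeight_pos n k).ne'
        rw [hcol k]
        field_simp

/-- ★★★ **THE MASS DERIVATIVE OF THE NEUMANN GREEN's FUNCTION**: `∂_{m²}G^Ω_{m²}(s,t) = −Σ_uG^Ω(s,u)G^Ω(u,t)` at every `m² > 0` (`c ≥ 0`; term-by-term in the cosine basis).
[cite: King1986, (2.17) p.653, §4 p.670 l.8–13] -/
theorem hasDerivAt_kingBoxGreen {c m2 : ℝ} (hc : 0 ≤ c) (hm : 0 < m2) (s t : KingBox n) :
    HasDerivAt (fun m : ℝ => kingBoxGreen n c m s t) (-(∑ u, kingBoxGreen n c m2 s u * kingBoxGreen n c m2 u t)) m2 := by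
  -- the closed form, term by term
  have hterm : ∀ k : KingBox n, HasDerivAt (fun m : ℝ => boxWave n k s * boxWave n k t / ((m + lapSym (dblPer n) c 0 (dblBox n k)) * boxWaveWeight n k))
      (-(boxWave n k s * boxWave n k t / ((m2 + lapSym (dblPer n) c 0 (dblBox n k)) ^ 2 * boxWaveWeight n k))) m2 := by
    intro k
    have hlam : 0 ≤ lapSym (dblPer n) c 0 (dblBox n k) := lapSym_ge (dblPer n) c 0 hc _
    have hW : 0 < boxWaveWeight n k := boxWaveWeight_pos n k
    have hpos : (m2 + lapSym (dblPer n) c 0 (dblBox n k)) * boxWaveWeight n k ≠ 0 := by positivity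
    have h1 : HasDerivAt (fun m : ℝ => (m + lapSym (dblPer n) c 0 (dblBox n k)) * boxWaveWeight n k) (1 * boxWaveWeight n k) m2 :=
      ((hasDerivAt_id m2).add_const _).mul_const _
    have h2 := (h1.inv hpos).const_mul (boxWave n k s * boxWave n k t)
    have e : boxWave n k s * boxWave n k t * (-(1 * boxWaveWeight n k) / ((m2 + lapSym (dblPer n) c 0 (dblBox n k)) * boxWaveWeight n k) ^ 2)
        = -(boxWave n k s * boxWave n k t / ((m2 + lapSym (dblPer n) c 0 (dblBox n k)) ^ 2 * boxWaveWeight n k)) := by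
      field_simp
    rw [e] at h2
    refine h2.congr_of_eventuallyEq (Filter.Eventually.of_forall fun m => ?_)
    simp only [div_eq_mul_inv, Pi.inv_apply]
  have hsum := HasDerivAt.fun_sum (u := Finset.univ) fun k _ => hterm k
  -- the value of the derivative
  have hval : ∑ k ∈ Finset.univ, -(boxWave n k s * boxWave n k t / ((m2 + lapSym (dblPer n) c 0 (dblBox n k)) ^ 2 * boxWaveWeight n k))
      = -(∑ u, kingBoxGreen n c m2 s u * kingBoxGreen n c m2 u t) := by
    rw [sum_kingBoxGreen_mul_kingBoxGreen n hc hm s t, ← Finset.sum_neg_distrib]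
    exact Finset.sum_congr rfl fun k _ => by rw [← lapSym_eq_add_mass]
  rw [hval] at hsum
  -- the function agrees with the closed form near `m2`
  refine hsum.congr_of_eventuallyEq ?_
  filter_upwards [Ioi_mem_nhds hm] with m hm'
  rw [kingBoxGreen_eq_sum_boxWave n hc hm' s t]
  exact Finset.sum_congr rfl fun k _ => by rw [← lapSym_eq_add_mass]

/-- ★★ on the diagonal: `∂_{m²}G^Ω(s,s) = −Σ_uG^Ω(s,u)²`. [cite: King1986, (2.17) p.653, §4 p.670 l.8–13] -/
theorem hasDerivAt_kingBoxGreen_diag {c m2 : ℝ} (hc : 0 ≤ c) (hm : 0 < m2) (s : KingBox n) :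
    HasDerivAt (fun m : ℝ => kingBoxGreen n c m s s) (-(∑ u, kingBoxGreen n c m2 s u ^ 2)) m2 := by
  have h := hasDerivAt_kingBoxGreen n hc hm s s
  have e : ∑ u, kingBoxGreen n c m2 s u * kingBoxGreen n c m2 u s = ∑ u, kingBoxGreen n c m2 s u ^ 2 :=
    Finset.sum_congr rfl fun u _ => by rw [kingBoxGreen_symm n c m2 s u, sq]
  rwa [e] at h

/-- ★ the derivative is non-positive and bounded: `−1∕m⁴ ≤ ∂_{m²}G^Ω(s,t) ≤ 0`. [cite: King1986, (2.17) p.653, §4 p.670 l.8–13] -/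
theorem deriv_kingBoxGreen_bounds {c m2 : ℝ} (hc : 0 ≤ c) (hm : 0 < m2) (s t : KingBox n) :
    deriv (fun m : ℝ => kingBoxGreen n c m s t) m2 ≤ 0 ∧ -(m2⁻¹ * m2⁻¹) ≤ deriv (fun m : ℝ => kingBoxGreen n c m s t) m2 := by
  rw [(hasDerivAt_kingBoxGreen n hc hm s t).deriv]
  have h := sum_kingBoxGreen_mul_kingBoxGreen_le n hc hm hm s t
  exact ⟨neg_nonpos.mpr h.1, neg_le_neg h.2⟩

end Derivative

end Summit.QuantumFields.YangMills.BalabanUVNodes.N15KingModelRung.TorusSpectral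

end
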